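import Literature.AlgebraicGeometry.Motives.HodgeThetaSubalgebraUnitaryFifteenSixteenRankTen
import HarnessLib

/-!
# The `Θ`-subalgebra theorem for unitary multiplicities `(15, 16)` — the last `p = 31` cell, closed classification-free
# by minimal-rank base points and the `XCX` identity (Ribet 1983 Thm. 3, Lie step; abelian 31-folds of type `(15, 16)`)

Family `hodge`, layer `Literature/AlgebraicGeometry/Motives` (pure linear algebra over `ℂ`; no geometry). Research
context: cell `pub-hodge-ring2` (HONEST FRAMING: research route conditional on HC_CM; not a corollary; Q11.4-sentence-2
already refuted in dim ≥ 3), Literature lane gen 87, programme R75. UNCONDITIONAL; theorems only, no definition, no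
named fact (D-0026), no `sorry`.

THE PRINT. K. A. Ribet, Amer. J. Math. 105 (1983), Thm. 3 = Gordon's survey Thm. 6.3 (3) [held
`paper:arxiv-alg-geom_9709030` p. 18]: `End⁰ = k` imaginary quadratic acting with coprime multiplicities `(n′, n″)` ⟹
`Hg = U(V, φ)`, `B•(Xⁿ) = D•(Xⁿ)`. The lane replaces Ribet's appeal to the classification of minuscule representations
pair by pair; `(15, 16)` is the last pair with `n′ + n″ ≤ 31`.

THE SETTING is that of the tree's unitary cores: `𝔊 ⊆ End_ℂ(W)` bracket-closed and irreducible, an involution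
`Θ ∈ 𝔊` with eigenspaces `P`, `Q` (`dim P = 15`, `dim Q = 16`), a Hermitian pairing `s` with `P ⊥ Q`, definite on
`P` and on `Q`, for which `𝔊` is adjoint-closed. For a raising `B` of rank `r` (adjoint `C`) the Levi pair
(`UnitaryLeviSetup.exists_levi_pair`) consists of `L⁺` on `U⁺ = (P ∩ U⁺) ⊕ (Q ∩ U⁺)` (type `(15 − r | r)`) and
`L⁻` on `U⁻ = B(W) ⊕ (Q ∩ ker B)` (type `(r | 16 − r)`); a raising `X` commuting with `ι` has profile `(i, j)`.

THE STATE BEFORE THIS FILE (`…FifteenSixteenReduction`, `…RankTwelve`, `…RankTen`): a proper `𝔊` has maximal raising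
rank exactly `10` and all raising ranks in `{0, 4, 6, 8, 10}`, not all in `{0, 10}`.

* §1 THE `XCX` IDENTITY at an arbitrary raising `B` with adjoint `C`. The involution `ι` of `B` is `s`-self-adjoint,
  so `U⁻ ⊥ U⁺`; consequently `C` kills `P ∩ U⁺` and maps `B(W)` injectively into `Q ∩ U⁺`
  (`UnitaryLeviSetup.adj_compat`). For a raising `X` commuting with `ι` the raising operator `XCX ∈ 𝔊` has rank at most
  `min(i, j)` (`finrank_range_mul_adj_mul_le`), and `XCX = 0` forces `i + j ≤ rk B` (`finrank_add_finrank_le`: `C`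
  embeds `X(U⁻)` into `ker X ∩ Q ∩ U⁺`). Also: a raising operator of EXACT prescribed rank in a graded space
  (`UnitaryRaisingSpace.exists_raise_finrank_range_eq`).
* §2 THE MINIMAL RANKS. (G8) `no_rank_four` (ranks in `{0, 4, 6, 8, 10}`): at a rank-`4` `B` the Levi algebra `L⁺`
  (type `(11 | 4)`) is full (`UnitaryFourCoprime.eq_top_eleven'`), so some `X` has `i = 3`, hence `j = 3` (`j = 1`
  would make `L⁻` of type `(4 | 12)` full on the larger side); `rk XCX ≤ 3 < 4` forces `XCX = 0`, so `6 = i + j ≤ 4`.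
  (G9) `no_rank_six` (ranks in `{0, 6, 8, 10}`): at a rank-`6` `B` every `X` has `min(i, j) ≤ 5`, so `XCX = 0` and
  `i + j ∈ {0, 6}`; `L⁺` (type `(9 | 6)`) is not full (lifts of profile `(6, 0)` and `(1, 5)` and two pencils give rank
  `11`), so `i ∉ {1, 2, 4, 5}` (rank one, cores `(2|7)`, `(4|5)`, `(5|4)` inside `L⁺`) and `j ∉ {1, 3}` (rank one,
  core `(3|7)` inside `L⁻` of type `(6 | 10)`): the profiles are `(0,0)`, `(0,6)`, `(6,0)`, and the two non-vanishing
  lemmas (for `ι` and `−ι`) with two pencils give rank `12`. (G10) `no_rank_eight` (ranks in `{0, 8, 10}`): at a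
  rank-`8` `B`, `XCX = 0` gives `i + j ∈ {0, 8}`; `L⁺` (type `(7 | 8)`) is full (`UnitarySeven.eq_top_of_smul`); lifts
  of profile `(7, 1)` and `(1, 7)` and two pencils give rank `14`.
* §3 **`UnitaryFifteenSixteen.eq_top_of_smul`** and the mirror `eq_top_of_smul'`: after §2 the ranks lie in `{0, 10}`,
  excluded by `UnitaryFifteenSixteen.no_constRank_ten`.

CONSEQUENCE (sequel `HodgeTheory/RibetTypeFifteenSixteenPowersHodgeClasses`): Ribet's theorem at `(n′, n″) = (15, 16)`
and the complete `p = 31` census — every simple complex abelian `31`-fold with `End⁰ ≠ ℚ` has `B• = D•` on all powers.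

## References
* [Ribet1983] K. A. Ribet, *Hodge classes on certain types of abelian varieties*, Amer. J. Math. 105 (1983), Thm. 3.
* [Gordon1997] B. B. Gordon, *A survey of the Hodge conjecture for abelian varieties*, Thm. 6.3 (3), pp. 18–19.
* [Deligne1982HodgeCycles] P. Deligne, *Hodge cycles on abelian varieties*, LNM 900 (1982), I §3 Prop. 3.4, 3.6.
* [GoodmanWallachGTM255] R. Goodman, N. R. Wallach, GTM 255 (2009), §4.1.1.
* [HoffmanKunze1971LinearAlgebra] K. Hoffman, R. Kunze, *Linear Algebra* (1971), §3.1 Thm. 2, §6.7, §8.3.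
-/

noncomputable section

open Module

namespace Literature.AlgebraicGeometry.Motives

namespace HodgeStructure

universe u

variable {W : Type u} [AddCommGroup W] [Module ℂ W]

/-! ### §1 The `XCX` identity at an arbitrary raising operator -/

/-- In a finite-dimensional space with an involution `ι` (eigenspaces `P'`, `Q'`), for `k ≤ dim P'`, `k ≤ dim Q'` there
is a raising operator `T` (`ιT = T = −Tι`) of rank EXACTLY `k` (send `k` basis vectors of `Q'` to `k` basis vectors of
`P'`, the others to `0`). [cite: HoffmanKunze1971LinearAlgebra, §3.1 Thm. 2, §6.7] -/
theorem UnitaryRaisingSpace.exists_raise_finrank_range_eq {U : Type*} [AddCommGroup U] [Module ℂ U]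
    [FiniteDimensional ℂ U] {ι : Module.End ℂ U} (hιι : ι * ι = 1) {P' Q' : Submodule ℂ U}
    (hP' : ∀ x, x ∈ P' ↔ ι x = x) (hQ' : ∀ x, x ∈ Q' ↔ ι x = -x) {k : ℕ} (hkP : k ≤ Module.finrank ℂ P')
    (hkQ : k ≤ Module.finrank ℂ Q') :
    ∃ T : Module.End ℂ U, ι * T = T ∧ T * ι = -T ∧ Module.finrank ℂ (LinearMap.range T) = k := by
  classical
  have hιv : ∀ v, ι (ι v) = v := fun v => by rw [← Module.End.mul_apply, hιι, Module.End.one_apply]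
  set bP := Module.finBasis ℂ P' with hbPdef
  set bQ := Module.finBasis ℂ Q' with hbQdef
  have hπmem : ∀ u : U, ((2 : ℂ)⁻¹ • (1 - ι)) u ∈ Q' := fun u => (hQ' _).2 (by
    simp only [LinearMap.smul_apply, LinearMap.sub_apply, Module.End.one_apply, map_smul, map_sub, hιv]
    rw [← smul_neg, neg_sub])
  set π : U →ₗ[ℂ] Q' := LinearMap.codRestrict Q' ((2 : ℂ)⁻¹ • (1 - ι)) hπmem with hπdef
  have hπval : ∀ u : U, ((π u : Q') : U) = (2 : ℂ)⁻¹ • (u - ι u) := fun u => by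
    simp only [hπdef, LinearMap.codRestrict_apply, LinearMap.smul_apply, LinearMap.sub_apply, Module.End.one_apply]
  have hπQ : ∀ q : Q', π (q : U) = q := fun q => Subtype.ext (by
    rw [hπval, (hQ' _).1 q.2]; module)
  have hπι : ∀ u : U, π (ι u) = -π u := fun u => Subtype.ext (by
    rw [hπval, Submodule.coe_neg, hπval, hιv]; module)
  set e : Fin k → U := fun l => ((bP (Fin.castLE hkP l) : P') : U) with hedef
  have he : LinearIndependent ℂ e := by
    have h1 : LinearIndependent ℂ (fun l : Fin k => bP (Fin.castLE hkP l)) :=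
      bP.linearIndependent.comp _ (Fin.castLE_injective hkP)
    exact h1.map' P'.subtype (Submodule.ker_subtype P')
  set g : Fin (Module.finrank ℂ Q') → U := fun i =>
    if h : (i : ℕ) < k then e ⟨i, h⟩ else 0 with hgdef
  have hgP : ∀ i, ι (g i) = g i := fun i => by
    by_cases h : (i : ℕ) < k
    · rw [hgdef]; simp only [h, dite_true, hedef]; exact (hP' _).1 (bP _).2
    · rw [hgdef]; simp only [h, dite_false, map_zero]
  have hgspan : ∀ i, g i ∈ Submodule.span ℂ (Set.range e) := fun i => by
    by_cases h : (i : ℕ) < k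
    · rw [hgdef]; simp only [h, dite_true]; exact Submodule.subset_span ⟨⟨i, h⟩, rfl⟩
    · rw [hgdef]; simp only [h, dite_false]; exact Submodule.zero_mem _
  set T : Module.End ℂ U := (bQ.constr ℂ g) ∘ₗ π with hTdef
  have hTapply : ∀ u, T u = bQ.constr ℂ g (π u) := fun u => rfl
  refine ⟨T, LinearMap.ext fun u => ?_, LinearMap.ext fun u => ?_, le_antisymm ?_ ?_⟩
  · rw [Module.End.mul_apply, hTapply, Basis.constr_apply_fintype, map_sum]
    refine Finset.sum_congr rfl fun i _ => ?_
    rw [map_smul, hgP]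
  · rw [Module.End.mul_apply, LinearMap.neg_apply, hTapply, hTapply, hπι, map_neg]
  · -- `T(U) ≤ span e`
    have hle : LinearMap.range T ≤ Submodule.span ℂ (Set.range e) := by
      rintro _ ⟨u, rfl⟩
      rw [hTapply, Basis.constr_apply_fintype]
      exact Submodule.sum_mem _ fun i _ => Submodule.smul_mem _ _ (hgspan i)
    have h := Submodule.finrank_mono hle
    rw [finrank_span_eq_card he, Fintype.card_fin] at h
    exact h
  · have hTe : ∀ l : Fin k, T ((bQ (Fin.castLE hkQ l) : Q') : U) = e l := fun l => by
      rw [hTapply, hπQ, Basis.constr_basis, hgdef]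
      simp only [Fin.val_castLE, Fin.is_lt, dite_true, Fin.eta]
    have hle : Submodule.span ℂ (Set.range e) ≤ LinearMap.range T := by
      rw [Submodule.span_le]
      rintro _ ⟨l, rfl⟩
      exact ⟨_, hTe l⟩
    have h := Submodule.finrank_mono hle
    rw [finrank_span_eq_card he, Fintype.card_fin] at h
    exact h

/-- **The adjoint and the involution are compatible.** For a raising `B ∈ 𝔊` with adjoint `C` and the involution `ι`
of `B` (`s`-self-adjoint, `U⁻ = {ι = −1} ⊇ B(W)`, `U⁺ = {ι = 1}`): `U⁻ ⊥ U⁺`, so `C` kills `P ∩ U⁺`, maps `B(W)` into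
`Q ∩ U⁺`, is injective on `B(W)`, and takes its values in `Q`. [cite: GoodmanWallachGTM255, §4.1.1]
[cite: HoffmanKunze1971LinearAlgebra, §8.3] -/
theorem UnitaryLeviSetup.adj_compat {Θ : Module.End ℂ W} (hΘΘ : Θ * Θ = 1)
    {P Q : Submodule ℂ W} (hP : ∀ x, x ∈ P ↔ Θ x = x) (hQ : ∀ x, x ∈ Q ↔ Θ x = -x)
    {s : W → W → ℂ} (hadd : ∀ x y z, s (x + y) z = s x z + s y z) (hsymm : ∀ x y, s y x = starRingEnd ℂ (s x y))
    (hPQ : ∀ p ∈ P, ∀ q ∈ Q, s p q = 0) (hdefP : ∀ p ∈ P, s p p = 0 → p = 0) (hdefQ : ∀ q ∈ Q, s q q = 0 → q = 0)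
    {B C : Module.End ℂ W} (hΘB : Θ * B = B) (hBΘ : B * Θ = -B) (hBC : ∀ x y, s (B x) y = s x (C y))
    (hrangeP : LinearMap.range B ≤ P)
    {ι : Module.End ℂ W} (hιι : ι * ι = 1) (hιΘ : ι * Θ = Θ * ι) (hιs : ∀ x y, s (ι x) y = s x (ι y))
    (hPM : ∀ x, x ∈ LinearMap.range B ↔ ι x = -x ∧ Θ x = x)
    (hQM : ∀ x, x ∈ Q ⊓ LinearMap.ker B ↔ ι x = -x ∧ Θ x = -x) :
    (∀ v, ι v = v → Θ v = v → C v = 0) ∧ (∀ p ∈ LinearMap.range B, ι (C p) = C p) ∧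
      (∀ p ∈ LinearMap.range B, C p = 0 → p = 0) ∧ (∀ w, Θ (C w) = -(C w)) := by
  classical
  obtain ⟨-, h0r, h0l, -, hnegl, -, hsubl⟩ := UnitaryTwoOdd.herm_right hadd hsymm
  have hιιv : ∀ v, ι (ι v) = v := fun v => by rw [← Module.End.mul_apply, hιι, Module.End.one_apply]
  have hΘι : ∀ v, Θ (ι v) = ι (Θ v) := fun v => by rw [← Module.End.mul_apply, ← hιΘ, Module.End.mul_apply]
  obtain ⟨hΘC, -⟩ := UnitaryTwoOdd.lower_of_adjoint hadd hsymm hΘΘ hP hQ hPQ hdefP hdefQ hΘB hBΘ hBC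
  have hCQ : ∀ w, Θ (C w) = -(C w) := fun w => by rw [← Module.End.mul_apply, hΘC, LinearMap.neg_apply]
  have hperp : ∀ u v, ι u = -u → ι v = v → s u v = 0 := fun u v hu hv => by
    have h : s u v = -s u v := by
      conv_lhs => rw [← hv, ← hιs, hu, hnegl]
    have h2 : (2 : ℂ) * s u v = 0 := by rw [two_mul]; nth_rewrite 2 [h]; rw [add_neg_cancel]
    exact (mul_eq_zero.1 h2).resolve_left two_ne_zero
  have hperp' : ∀ v u, ι v = v → ι u = -u → s v u = 0 := fun v u hv hu => by
    rw [hsymm, hperp u v hu hv, map_zero]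
  refine ⟨fun v hv hΘv => ?_, fun p hp => ?_, ?_, hCQ⟩
  · refine hdefQ _ ((hQ _).2 (hCQ v)) ?_
    rw [← hBC, hperp _ _ ((hPM _).1 (LinearMap.mem_range_self B _)).1 hv]
  · set b := (2 : ℂ)⁻¹ • (C p - ι (C p)) with hb
    have hιb : ι b = -b := by rw [hb, map_smul, map_sub, hιιv, ← smul_neg, neg_sub]
    have hΘb : Θ b = -b := by
      rw [hb, map_smul, map_sub, hΘι, hCQ, map_neg, ← smul_neg, neg_sub, sub_neg_eq_add, neg_add_eq_sub]
    have hbD := (hQM b).2 ⟨hιb, hΘb⟩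
    have hBb : B b = 0 := LinearMap.mem_ker.1 (Submodule.mem_inf.1 hbD).2
    have hιa : ι (C p - b) = C p - b := by
      have : C p - b = (2 : ℂ)⁻¹ • (C p + ι (C p)) := by rw [hb]; module
      rw [this, map_smul, map_add, hιιv, add_comm]
    have hsbb : s b b = 0 := by
      have h1 : s (C p) b = 0 := by
        rw [hsymm, ← hBC, hBb, h0l, map_zero]
      have h3 : s (C p - b) b = 0 := hperp' _ _ hιa hιb
      rw [hsubl, h1, zero_sub, neg_eq_zero] at h3
      exact h3
    have hb0 : b = 0 := hdefQ b ((hQ b).2 hΘb) hsbb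
    have hcp : C p = (C p - b) + b := by rw [sub_add_cancel]
    rw [hcp, hb0, add_zero]
    simpa only [hb0, sub_zero] using hιa
  · rintro _ ⟨w, rfl⟩ hCp
    exact hdefP _ (hrangeP (LinearMap.mem_range_self B w)) (by rw [hBC, hCp, h0r])

/-- **`rk XCX ≤ min(i, j)`** for a raising `X` commuting with `ι` (notation of `adj_compat`): `XCX` factors through
`X|_{U⁻}` and takes its values in `X(U⁺)`. [cite: HoffmanKunze1971LinearAlgebra, §3.1 Thm. 2] -/
theorem UnitaryLeviSetup.finrank_range_mul_adj_mul_le [FiniteDimensional ℂ W] {Θ : Module.End ℂ W}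
    {B C : Module.End ℂ W} {ι : Module.End ℂ W} {Um Up : Submodule ℂ W} (hιι : ι * ι = 1)
    (hUm : ∀ x, x ∈ Um ↔ ι x = -x) (hUp : ∀ x, x ∈ Up ↔ ι x = x)
    (hPM : ∀ x, x ∈ LinearMap.range B ↔ ι x = -x ∧ Θ x = x)
    (hCPU : ∀ v, ι v = v → Θ v = v → C v = 0) (hCim : ∀ p ∈ LinearMap.range B, ι (C p) = C p)
    {X : Module.End ℂ W} (hΘX : Θ * X = X) (hXc : X * ι = ι * X) :
    Module.finrank ℂ (LinearMap.range (X * C * X)) ≤ Module.finrank ℂ (Up.map X) ∧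
      Module.finrank ℂ (LinearMap.range (X * C * X)) ≤ Module.finrank ℂ (Um.map X) := by
  have hιιv : ∀ v, ι (ι v) = v := fun v => by rw [← Module.End.mul_apply, hιι, Module.End.one_apply]
  have hXι : ∀ v, X (ι v) = ι (X v) := fun v => by rw [← Module.End.mul_apply, hXc, Module.End.mul_apply]
  have hΘXv : ∀ w, Θ (X w) = X w := fun w => by rw [← Module.End.mul_apply, hΘX]
  -- decomposition of `X w` along `U⁺ ⊕ U⁻`
  have hdec : ∀ w, X (C (X w)) = X (C (X ((2 : ℂ)⁻¹ • (w - ι w)))) ∧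
      X ((2 : ℂ)⁻¹ • (w - ι w)) ∈ Um.map X ∧ C (X ((2 : ℂ)⁻¹ • (w - ι w))) ∈ Up := by
    intro w
    set wp := (2 : ℂ)⁻¹ • (w + ι w) with hwp
    set wm := (2 : ℂ)⁻¹ • (w - ι w) with hwm
    have hιwp : ι wp = wp := by rw [hwp, map_smul, map_add, hιιv, add_comm]
    have hιwm : ι wm = -wm := by rw [hwm, map_smul, map_sub, hιιv, ← smul_neg, neg_sub]
    have hw : w = wp + wm := by rw [hwp, hwm]; module
    have hXwp : C (X wp) = 0 := hCPU _ (by rw [← hXι, hιwp]) (hΘXv wp)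
    have hXwm : X wm ∈ LinearMap.range B := (hPM _).2 ⟨by rw [← hXι, hιwm, map_neg], hΘXv wm⟩
    refine ⟨by rw [hw, map_add, map_add, hXwp, map_add, map_zero, zero_add], Submodule.mem_map_of_mem ((hUm _).2 hιwm),
      (hUp _).2 (hCim _ hXwm)⟩
  constructor
  · refine Submodule.finrank_mono ?_
    rintro _ ⟨w, rfl⟩
    obtain ⟨h1, -, h3⟩ := hdec w
    rw [Module.End.mul_apply, Module.End.mul_apply, h1]
    exact Submodule.mem_map_of_mem h3
  · -- `XCX` factors through `X(U⁻)`
    have hle : LinearMap.range (X * C * X) ≤ (Um.map X).map (X * C) := by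
      rintro _ ⟨w, rfl⟩
      obtain ⟨h1, h2, -⟩ := hdec w
      rw [Module.End.mul_apply, Module.End.mul_apply, h1]
      exact ⟨_, h2, rfl⟩
    exact (Submodule.finrank_mono hle).trans (Submodule.finrank_map_le _ _)

/-- **`XCX = 0` forces `i + j ≤ rk B`.** For a raising `X` commuting with `ι` with `XCX = 0` (notation of
`adj_compat`): `C` embeds `X(U⁻) ⊆ B(W)` into the kernel of `X` on `Q ∩ U⁺`, whose dimension is `rk B − i`.
[cite: HoffmanKunze1971LinearAlgebra, §3.1 Thm. 2] [cite: GoodmanWallachGTM255, §4.1.1] -/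
theorem UnitaryLeviSetup.finrank_add_finrank_le [FiniteDimensional ℂ W] {Θ : Module.End ℂ W} (hΘΘ : Θ * Θ = 1)
    {B C : Module.End ℂ W} {ι : Module.End ℂ W} {Um Up QU : Submodule ℂ W} (hιι : ι * ι = 1) (hιΘ : ι * Θ = Θ * ι)
    (hUm : ∀ x, x ∈ Um ↔ ι x = -x) (hUp : ∀ x, x ∈ Up ↔ ι x = x)
    (hPM : ∀ x, x ∈ LinearMap.range B ↔ ι x = -x ∧ Θ x = x) (hQU : ∀ x, x ∈ QU ↔ ι x = x ∧ Θ x = -x)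
    (hfinQU : Module.finrank ℂ QU = Module.finrank ℂ (LinearMap.range B))
    (hCim : ∀ p ∈ LinearMap.range B, ι (C p) = C p) (hCinj : ∀ p ∈ LinearMap.range B, C p = 0 → p = 0)
    (hCQ : ∀ w, Θ (C w) = -(C w))
    {X : Module.End ℂ W} (hΘX : Θ * X = X) (hXΘ : X * Θ = -X) (hXc : X * ι = ι * X) (hXCX : X * C * X = 0) :
    Module.finrank ℂ (Up.map X) + Module.finrank ℂ (Um.map X) ≤ Module.finrank ℂ (LinearMap.range B) := by
  classical
  have hιιv : ∀ v, ι (ι v) = v := fun v => by rw [← Module.End.mul_apply, hιι, Module.End.one_apply]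
  have hΘι : ∀ v, Θ (ι v) = ι (Θ v) := fun v => by rw [← Module.End.mul_apply, ← hιΘ, Module.End.mul_apply]
  have hΘΘv : ∀ v, Θ (Θ v) = v := fun v => by rw [← Module.End.mul_apply, hΘΘ, Module.End.one_apply]
  have hXι : ∀ v, X (ι v) = ι (X v) := fun v => by rw [← Module.End.mul_apply, hXc, Module.End.mul_apply]
  have hΘXv : ∀ w, Θ (X w) = X w := fun w => by rw [← Module.End.mul_apply, hΘX]
  have hraiseP : ∀ p, Θ p = p → X p = 0 := fun p hp => by
    have h : X p = -(X p) := by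
      conv_lhs => rw [← hp, ← Module.End.mul_apply, hXΘ, LinearMap.neg_apply]
    have h2 : (2 : ℂ) • X p = 0 := by rw [two_smul]; nth_rewrite 2 [h]; rw [add_neg_cancel]
    exact (smul_eq_zero.1 h2).resolve_left two_ne_zero
  -- `X(U⁺) = X(Q ∩ U⁺)`
  have hmapUp : Up.map X = QU.map X := by
    refine le_antisymm ?_ (Submodule.map_mono fun x hx => (hUp x).2 ((hQU x).1 hx).1)
    rintro _ ⟨v, hv, rfl⟩
    have hιv := (hUp v).1 hv
    have hv' : v = (2 : ℂ)⁻¹ • (v + Θ v) + (2 : ℂ)⁻¹ • (v - Θ v) := by module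
    have hvP : Θ ((2 : ℂ)⁻¹ • (v + Θ v)) = (2 : ℂ)⁻¹ • (v + Θ v) := by rw [map_smul, map_add, hΘΘv, add_comm]
    have hvQ : (2 : ℂ)⁻¹ • (v - Θ v) ∈ QU := (hQU _).2 ⟨by rw [map_smul, map_sub, ← hΘι, hιv], by
      rw [map_smul, map_sub, hΘΘv, ← smul_neg, neg_sub]⟩
    refine ⟨_, hvQ, ?_⟩
    conv_rhs => rw [hv', map_add, hraiseP _ hvP, zero_add]
  -- `X(U⁻) ⊆ B(W)`
  have hVle : Um.map X ≤ LinearMap.range B := by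
    rintro _ ⟨u, hu, rfl⟩
    exact (hPM _).2 ⟨by rw [← hXι, (hUm u).1 hu, map_neg], hΘXv u⟩
  -- the embedding `C : X(U⁻) → ker (X|_{Q ∩ U⁺})`
  have hCmemQU : ∀ p ∈ Um.map X, C p ∈ QU := fun p hp => (hQU _).2 ⟨hCim p (hVle hp), hCQ p⟩
  have hCker : ∀ p ∈ Um.map X, X (C p) = 0 := by
    rintro _ ⟨u, hu, rfl⟩
    have h := congrArg (fun T : Module.End ℂ W => T u) hXCX
    simpa only [Module.End.mul_apply, LinearMap.zero_apply] using h
  set g : ↥(Um.map X) →ₗ[ℂ] ↥(LinearMap.ker (X.domRestrict QU)) :=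
    { toFun := fun p => ⟨⟨C p, hCmemQU p p.2⟩, by
        rw [LinearMap.mem_ker, LinearMap.domRestrict_apply]; exact hCker p p.2⟩
      map_add' := fun p q => by ext; simp only [Submodule.coe_add, map_add]
      map_smul' := fun c p => by ext; simp only [Submodule.coe_smul, map_smul, RingHom.id_apply] } with hg
  have hginj : Function.Injective g := by
    intro p q hpq
    have h : C (p : W) = C (q : W) := by
      have := congrArg (fun x : ↥(LinearMap.ker (X.domRestrict QU)) => ((x : QU) : W)) hpq
      simpa [hg] using this
    have hsub : C ((p : W) - q) = 0 := by rw [map_sub, h, sub_self]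
    have h0 := hCinj _ (hVle (Submodule.sub_mem _ p.2 q.2)) hsub
    exact Subtype.ext (sub_eq_zero.1 h0)
  have h1 := LinearMap.finrank_le_finrank_of_injective hginj
  have h2 := LinearMap.finrank_range_add_finrank_ker (X.domRestrict QU)
  rw [LinearMap.range_domRestrict] at h2
  rw [hmapUp, ← hfinQU]
  omega

/-! ### §2 The minimal ranks `4`, `6`, `8` -/

/-- (G8) At `(15, 16)` with ranks in `{0, 4, 6, 8, 10}`, no raising operator has rank `4`: at such a `B` the Levi
algebra `L⁺` (type `(11 | 4)`) is full (`UnitaryFourCoprime.eq_top_eleven'`), so some raising `X` commuting with `ι`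
has `i = 3`; then `j = 3` (`j = 1` would make `L⁻`, of type `(4 | 12)`, full on the larger side); `rk XCX ≤ 3 < 4`
forces `XCX = 0`, whence `6 = i + j ≤ rk B = 4`. [cite: Ribet1983, Thm. 3] [cite: Gordon1997, Thm. 6.3 (3)]
[cite: Deligne1982HodgeCycles, I §3 Prop. 3.4, 3.6] [cite: GoodmanWallachGTM255, §4.1.1] -/
theorem UnitaryFifteenSixteen.no_rank_four [FiniteDimensional ℂ W] {𝔊 : Submodule ℂ (Module.End ℂ W)}
    (hbr : ∀ Y ∈ 𝔊, ∀ Z ∈ 𝔊, Y * Z - Z * Y ∈ 𝔊)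
    (hirr : ∀ U : Submodule ℂ W, (∀ A ∈ 𝔊, ∀ u ∈ U, A u ∈ U) → U = ⊥ ∨ U = ⊤)
    {Θ : Module.End ℂ W} (hΘ : Θ ∈ 𝔊) (hΘΘ : Θ * Θ = 1)
    {P Q : Submodule ℂ W} (hP : ∀ x, x ∈ P ↔ Θ x = x) (hQ : ∀ x, x ∈ Q ↔ Θ x = -x)
    (hP15 : Module.finrank ℂ P = 15) (hQ16 : Module.finrank ℂ Q = 16)
    {s : W → W → ℂ} (hadd : ∀ x y z, s (x + y) z = s x z + s y z)
    (hsymm : ∀ x y, s y x = starRingEnd ℂ (s x y))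
    (hPQ : ∀ p ∈ P, ∀ q ∈ Q, s p q = 0) (hdefP : ∀ p ∈ P, s p p = 0 → p = 0) (hdefQ : ∀ q ∈ Q, s q q = 0 → q = 0)
    (hadj : ∀ X ∈ 𝔊, ∃ Y ∈ 𝔊, ∀ x y, s (X x) y = s x (Y y))
    (hS : ∀ B' ∈ 𝔊, Θ * B' = B' → B' * Θ = -B' →
      Module.finrank ℂ (LinearMap.range B') = 0 ∨ Module.finrank ℂ (LinearMap.range B') = 4 ∨ Module.finrank ℂ (LinearMap.range B') = 6 ∨ Module.finrank ℂ (LinearMap.range B') = 8 ∨ Module.finrank ℂ (LinearMap.range B') = 10)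
    {B : Module.End ℂ W} (hB : B ∈ 𝔊) (hΘB : Θ * B = B) (hBΘ : B * Θ = -B)
    (hr : Module.finrank ℂ (LinearMap.range B) = 4) : False := by
  classical
  have hsU : ∀ U : Submodule ℂ W, ∀ x y z : U, s ((x + y : U) : W) z = s (x : W) z + s (y : W) z :=
    fun U x y z => by simp only [Submodule.coe_add, hadd]
  have hno1 : ∀ B' ∈ 𝔊, Θ * B' = B' → B' * Θ = -B' → Module.finrank ℂ (LinearMap.range B') ≠ 1 := by
    intro B' hB' hΘB' hB'Θ h1
    rcases hS B' hB' hΘB' hB'Θ with h | h | h | h | h <;> omega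
  obtain ⟨ι, Um, Up, PU, QU, Lm, ιm, Pm, Qm, Lp, ιp, Pp, Qp, hιmem, hιι, hιΘ, hιs, hUm, hUp, hfinUm, hfinUp,
    hPM, hQM, hPU, hQU, hrangeP, hPUP, hQUQ, hfinQM, hfinPU, hfinQU, hLm, hLp,
    hιmapply, hPmmem, hQmmem, hbrLm, hirrLm, hιmmem, hιmιm, hPm, hQm, hfinPm, hfinQm, hPmQm, hdefPm, hdefQm, hadjLm,
    hιpapply, hPpmem, hQpmem, hbrLp, hirrLp, hιpmem, hιpιp, hPp, hQp, hfinPp, hfinQp, hPpQp, hdefPp, hdefQp, hadjLp,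
    hsplit⟩ :=
    UnitaryLeviSetup.exists_levi_pair hbr hirr hΘ hΘΘ hP hQ hadd hsymm hPQ hdefP hdefQ hadj hB hΘB hBΘ
  have hfinQU' := hfinQU
  rw [hr] at hfinQM hfinPU hfinQU' hfinPm hfinQm hfinPp hfinQp hsplit
  rw [hQ16] at hfinQM hfinQm hfinUm
  rw [hP15] at hfinPU hfinPp hfinUp
  have hcm : ∀ Z : Module.End ℂ W, Z * ι = ι * Z → ∀ x ∈ Um, Z x ∈ Um := fun Z hZ x hx =>
    (hUm _).2 (by rw [← Module.End.mul_apply, ← hZ, Module.End.mul_apply, (hUm x).1 hx, map_neg])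
  have hcp : ∀ Z : Module.End ℂ W, Z * ι = ι * Z → ∀ x ∈ Up, Z x ∈ Up := fun Z hZ x hx =>
    (hUp _).2 (by rw [← Module.End.mul_apply, ← hZ, Module.End.mul_apply, (hUp x).1 hx])
  -- the adjoint `C` of `B` and the `XCX` identity
  obtain ⟨C, hC, hBC⟩ := hadj B hB
  obtain ⟨hCPU, hCim, hCinj, hCQ⟩ := UnitaryLeviSetup.adj_compat hΘΘ hP hQ hadd hsymm hPQ hdefP hdefQ hΘB hBΘ hBC hrangeP
    hιι hιΘ hιs hPM hQM
  have hXCX : ∀ X ∈ 𝔊, Θ * X = X → X * Θ = -X → X * ι = ι * X →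
      X * C * X ∈ 𝔊 ∧ Θ * (X * C * X) = X * C * X ∧ X * C * X * Θ = -(X * C * X) ∧
        Module.finrank ℂ (LinearMap.range (X * C * X)) ≤ Module.finrank ℂ (Up.map X) ∧
        Module.finrank ℂ (LinearMap.range (X * C * X)) ≤ Module.finrank ℂ (Um.map X) := by
    intro X hX hΘX hXΘ hXc
    have hT2 := UnitaryRaisingSpace.bracket_bracket_mem hbr hX hC hX hΘX hXΘ hΘX hXΘ
    have hTmem : X * C * X ∈ 𝔊 := by
      have h := Submodule.smul_mem 𝔊 ((2 : ℂ)⁻¹) hT2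
      rwa [← two_smul ℂ, smul_smul, inv_mul_cancel₀ (two_ne_zero (α := ℂ)), one_smul] at h
    obtain ⟨hle1, hle2⟩ := UnitaryLeviSetup.finrank_range_mul_adj_mul_le hιι hUm hUp hPM hCPU hCim hΘX hXc
    exact ⟨hTmem, by rw [← mul_assoc, ← mul_assoc, hΘX], by rw [mul_assoc, hXΘ, mul_neg], hle1, hle2⟩
  have hfullm_of : Lm = ⊤ → False := fun h =>
    UnitaryLeviSetup.false_of_full_larger hbr hΘΘ hno1 hιι hιΘ hUm hUp (by omega) (by omega) hPM hQM (by omega)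
      (by omega) hLm h
  -- `L⁺` (type `(11 | 4)`) is full
  have hLptop : Lp = ⊤ :=
    UnitaryFourCoprime.eq_top_eleven' hbrLp hirrLp hιpmem hιpιp hPp hQp (by omega) (by omega)
      (s := fun v w : Up => s (v : W) w) (hsU Up) (fun v w => hsymm v w) hPpQp hdefPp hdefQp hadjLp
  -- a lift with `i = 3`
  obtain ⟨T, hιT, hTι, hT3⟩ := UnitaryRaisingSpace.exists_raise_finrank_range_eq hιpιp hPp hQp (k := 3) (by omega)
    (by omega)
  obtain ⟨X, hX, hΘX, hXΘ, hXc, hXUp⟩ := UnitaryLeviSetup.exists_lift hbr hΘ hΘΘ hcp hιΘ hLp hιpapply T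
    (by rw [hLptop]; exact Submodule.mem_top) hιT hTι
  rw [hT3] at hXUp
  -- `j = 3`
  have hj1 : Module.finrank ℂ (Um.map X) ≠ 1 := by
    intro h1
    obtain ⟨hxmem, hιmx, hxιm, hxrk⟩ := UnitaryLeviSetup.restrict_mem hcm hLm hιmapply X hX hΘX hXΘ hXc
    rw [h1] at hxrk
    exact hfullm_of (UnitaryRankOneRaise.eq_top_of_rankOne_raise hbrLm hirrLm hιmmem hιmιm hPm hQm
      (s := fun v w : Um => s (v : W) w) (hsU Um) (fun v w => hsymm v w) hPmQm hdefPm hdefQm hadjLm hxmem hιmx hxιm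
      hxrk (by omega) (by omega) (by omega))
  obtain ⟨hs, hi, hi', hj, hj'⟩ := hsplit X hΘX hXΘ hXc
  have hrk := hS X hX hΘX hXΘ
  rw [hs, hXUp] at hrk
  have hj3 : Module.finrank ℂ (Um.map X) = 3 := by omega
  -- `XCX = 0`, so `i + j ≤ 4`
  obtain ⟨hTmem, hΘT, hTΘ, hle1, -⟩ := hXCX X hX hΘX hXΘ hXc
  have hT0 : X * C * X = 0 := by
    have h := hS _ hTmem hΘT hTΘ
    rw [hXUp] at hle1
    have h0 : Module.finrank ℂ (LinearMap.range (X * C * X)) = 0 := by omega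
    exact LinearMap.range_eq_bot.1 (Submodule.finrank_eq_zero.1 h0)
  have hsum := UnitaryLeviSetup.finrank_add_finrank_le hΘΘ hιι hιΘ hUm hUp hPM hQU hfinQU hCim hCinj hCQ hΘX hXΘ hXc hT0
  rw [hXUp, hj3, hr] at hsum
  omega

/-- (G9) At `(15, 16)` with ranks in `{0, 6, 8, 10}`, no raising operator has rank `6`: at such a `B` (Levi types
`(9 | 6)` / `(6 | 10)`) every raising `X` commuting with `ι` has `min(i, j) ≤ 5`, so `XCX = 0` and `i + j ∈ {0, 6}`;
`L⁺` is not full (lifts of profiles `(6, 0)` and `(1, 5)` and two pencils give rank `11`), hence `i ∉ {1, 2, 4, 5}`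
(rank one, cores `(2|7)`, `(4|5)`, `(5|4)` inside `L⁺`) and `j ∉ {1, 3}` (rank one, core `(3|7)` inside `L⁻`); the
profiles are `(0,0)`, `(0,6)`, `(6,0)`, and the non-vanishing lemmas for `ι` and `−ι` with two pencils give rank `12`.
[cite: Ribet1983, Thm. 3] [cite: Gordon1997, Thm. 6.3 (3)] [cite: Deligne1982HodgeCycles, I §3 Prop. 3.4, 3.6]
[cite: GoodmanWallachGTM255, §4.1.1] [cite: HoffmanKunze1971LinearAlgebra, §3.1 Thm. 2] -/
theorem UnitaryFifteenSixteen.no_rank_six [FiniteDimensional ℂ W] {𝔊 : Submodule ℂ (Module.End ℂ W)}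
    (hbr : ∀ Y ∈ 𝔊, ∀ Z ∈ 𝔊, Y * Z - Z * Y ∈ 𝔊)
    (hirr : ∀ U : Submodule ℂ W, (∀ A ∈ 𝔊, ∀ u ∈ U, A u ∈ U) → U = ⊥ ∨ U = ⊤)
    {Θ : Module.End ℂ W} (hΘ : Θ ∈ 𝔊) (hΘΘ : Θ * Θ = 1)
    {P Q : Submodule ℂ W} (hP : ∀ x, x ∈ P ↔ Θ x = x) (hQ : ∀ x, x ∈ Q ↔ Θ x = -x)
    (hP15 : Module.finrank ℂ P = 15) (hQ16 : Module.finrank ℂ Q = 16)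
    {s : W → W → ℂ} (hadd : ∀ x y z, s (x + y) z = s x z + s y z)
    (hsymm : ∀ x y, s y x = starRingEnd ℂ (s x y))
    (hPQ : ∀ p ∈ P, ∀ q ∈ Q, s p q = 0) (hdefP : ∀ p ∈ P, s p p = 0 → p = 0) (hdefQ : ∀ q ∈ Q, s q q = 0 → q = 0)
    (hadj : ∀ X ∈ 𝔊, ∃ Y ∈ 𝔊, ∀ x y, s (X x) y = s x (Y y))
    (hS : ∀ B' ∈ 𝔊, Θ * B' = B' → B' * Θ = -B' →
      Module.finrank ℂ (LinearMap.range B') = 0 ∨ Module.finrank ℂ (LinearMap.range B') = 6 ∨ Module.finrank ℂ (LinearMap.range B') = 8 ∨ Module.finrank ℂ (LinearMap.range B') = 10)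
    {B : Module.End ℂ W} (hB : B ∈ 𝔊) (hΘB : Θ * B = B) (hBΘ : B * Θ = -B)
    (hr : Module.finrank ℂ (LinearMap.range B) = 6) : False := by
  classical
  have hsU : ∀ U : Submodule ℂ W, ∀ x y z : U, s ((x + y : U) : W) z = s (x : W) z + s (y : W) z :=
    fun U x y z => by simp only [Submodule.coe_add, hadd]
  have hno1 : ∀ B' ∈ 𝔊, Θ * B' = B' → B' * Θ = -B' → Module.finrank ℂ (LinearMap.range B') ≠ 1 := by
    intro B' hB' hΘB' hB'Θ h1
    rcases hS B' hB' hΘB' hB'Θ with h | h | h | h <;> omega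
  obtain ⟨ι, Um, Up, PU, QU, Lm, ιm, Pm, Qm, Lp, ιp, Pp, Qp, hιmem, hιι, hιΘ, hιs, hUm, hUp, hfinUm, hfinUp,
    hPM, hQM, hPU, hQU, hrangeP, hPUP, hQUQ, hfinQM, hfinPU, hfinQU, hLm, hLp,
    hιmapply, hPmmem, hQmmem, hbrLm, hirrLm, hιmmem, hιmιm, hPm, hQm, hfinPm, hfinQm, hPmQm, hdefPm, hdefQm, hadjLm,
    hιpapply, hPpmem, hQpmem, hbrLp, hirrLp, hιpmem, hιpιp, hPp, hQp, hfinPp, hfinQp, hPpQp, hdefPp, hdefQp, hadjLp,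
    hsplit⟩ :=
    UnitaryLeviSetup.exists_levi_pair hbr hirr hΘ hΘΘ hP hQ hadd hsymm hPQ hdefP hdefQ hadj hB hΘB hBΘ
  have hfinQU' := hfinQU
  rw [hr] at hfinQM hfinPU hfinQU' hfinPm hfinQm hfinPp hfinQp hsplit
  rw [hQ16] at hfinQM hfinQm hfinUm
  rw [hP15] at hfinPU hfinPp hfinUp
  have hcm : ∀ Z : Module.End ℂ W, Z * ι = ι * Z → ∀ x ∈ Um, Z x ∈ Um := fun Z hZ x hx =>
    (hUm _).2 (by rw [← Module.End.mul_apply, ← hZ, Module.End.mul_apply, (hUm x).1 hx, map_neg])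
  have hcp : ∀ Z : Module.End ℂ W, Z * ι = ι * Z → ∀ x ∈ Up, Z x ∈ Up := fun Z hZ x hx =>
    (hUp _).2 (by rw [← Module.End.mul_apply, ← hZ, Module.End.mul_apply, (hUp x).1 hx])
  -- the adjoint `C` of `B` and the `XCX` identity
  obtain ⟨C, hC, hBC⟩ := hadj B hB
  obtain ⟨hCPU, hCim, hCinj, hCQ⟩ := UnitaryLeviSetup.adj_compat hΘΘ hP hQ hadd hsymm hPQ hdefP hdefQ hΘB hBΘ hBC hrangeP
    hιι hιΘ hιs hPM hQM
  have hXCX : ∀ X ∈ 𝔊, Θ * X = X → X * Θ = -X → X * ι = ι * X →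
      X * C * X ∈ 𝔊 ∧ Θ * (X * C * X) = X * C * X ∧ X * C * X * Θ = -(X * C * X) ∧
        Module.finrank ℂ (LinearMap.range (X * C * X)) ≤ Module.finrank ℂ (Up.map X) ∧
        Module.finrank ℂ (LinearMap.range (X * C * X)) ≤ Module.finrank ℂ (Um.map X) := by
    intro X hX hΘX hXΘ hXc
    have hT2 := UnitaryRaisingSpace.bracket_bracket_mem hbr hX hC hX hΘX hXΘ hΘX hXΘ
    have hTmem : X * C * X ∈ 𝔊 := by
      have h := Submodule.smul_mem 𝔊 ((2 : ℂ)⁻¹) hT2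
      rwa [← two_smul ℂ, smul_smul, inv_mul_cancel₀ (two_ne_zero (α := ℂ)), one_smul] at h
    obtain ⟨hle1, hle2⟩ := UnitaryLeviSetup.finrank_range_mul_adj_mul_le hιι hUm hUp hPM hCPU hCim hΘX hXc
    exact ⟨hTmem, by rw [← mul_assoc, ← mul_assoc, hΘX], by rw [mul_assoc, hXΘ, mul_neg], hle1, hle2⟩
  have hfullm_of : Lm = ⊤ → False := fun h =>
    UnitaryLeviSetup.false_of_full_larger hbr hΘΘ hno1 hιι hιΘ hUm hUp (by omega) (by omega) hPM hQM (by omega)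
      (by omega) hLm h
  -- `XCX = 0` for every raising `X` commuting with `ι`: `i + j ≤ 6`
  have hsum : ∀ X ∈ 𝔊, Θ * X = X → X * Θ = -X → X * ι = ι * X →
      Module.finrank ℂ (Up.map X) + Module.finrank ℂ (Um.map X) ≤ 6 := by
    intro X hX hΘX hXΘ hXc
    obtain ⟨hs, hi, hi', hj, hj'⟩ := hsplit X hΘX hXΘ hXc
    have hrk := hS X hX hΘX hXΘ
    rw [hs] at hrk
    obtain ⟨hTmem, hΘT, hTΘ, hle1, hle2⟩ := hXCX X hX hΘX hXΘ hXc
    have hT0 : X * C * X = 0 := by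
      have h := hS _ hTmem hΘT hTΘ
      have h0 : Module.finrank ℂ (LinearMap.range (X * C * X)) = 0 := by omega
      exact LinearMap.range_eq_bot.1 (Submodule.finrank_eq_zero.1 h0)
    have h := UnitaryLeviSetup.finrank_add_finrank_le hΘΘ hιι hιΘ hUm hUp hPM hQU hfinQU hCim hCinj hCQ hΘX hXΘ hXc hT0
    rw [hr] at h
    exact h
  -- `L⁺` (type `(9 | 6)`) is not full
  have hfullp_of : Lp = ⊤ → False := by
    intro hLptop
    have hfullp : ∀ T : Module.End ℂ Up, ∃ Z ∈ 𝔊, Z * ι = ι * Z ∧ ∀ v : Up, ((T v : Up) : W) = Z v := fun T =>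
      (hLp T).1 (by rw [hLptop]; exact Submodule.mem_top)
    obtain ⟨X₆, hX₆, hΘX₆, hX₆Θ, hX₆c, h6le⟩ := UnitaryLeviSetup.exists_lift_le_finrank hbr hΘ hΘΘ hcp hιΘ hLp hιpapply
      hιpιp hPp hQp hLptop (k := 6) (by omega) (by omega)
    obtain ⟨X₁, hX₁, hΘX₁, hX₁Θ, hX₁c, hi1⟩ := UnitaryLeviSetup.exists_lift_rankOne hbr hΘ hΘΘ hιΘ hUp hPU hQU (by omega)
      (by omega) hfullp
    obtain ⟨hs₆, hi₆, hi₆', -, -⟩ := hsplit X₆ hΘX₆ hX₆Θ hX₆c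
    obtain ⟨hs₁, -, -, hj₁, -⟩ := hsplit X₁ hΘX₁ hX₁Θ hX₁c
    have hsum₆ := hsum X₆ hX₆ hΘX₆ hX₆Θ hX₆c
    have hsum₁ := hsum X₁ hX₁ hΘX₁ hX₁Θ hX₁c
    have hrk₁ := hS X₁ hX₁ hΘX₁ hX₁Θ
    rw [hs₁, hi1] at hrk₁
    have hj5 : Module.finrank ℂ (Um.map X₁) = 5 := by omega
    have hi6 : Module.finrank ℂ (Up.map X₆) = 6 := by omega
    obtain ⟨c, hc1, hc2⟩ := UnitaryGenericRank.exists_finrank_le_and_finrank_le (X₁.restrict (hcm X₁ hX₁c))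
      (X₆.restrict (hcm X₆ hX₆c)) (X₆.restrict (hcp X₆ hX₆c)) (X₁.restrict (hcp X₁ hX₁c))
    obtain ⟨hY, hΘY, hYΘ, hYc⟩ := UnitaryLeviSetup.add_smul_raise X₆ hX₆ hΘX₆ hX₆Θ hX₆c X₁ hX₁ hΘX₁ hX₁Θ hX₁c c
    have hiY := UnitaryLeviSetup.finrank_map_add_smul hcp X₆ X₁ hX₆c hX₁c c hYc
    have hjY := UnitaryLeviSetup.finrank_map_add_smul hcm X₆ X₁ hX₆c hX₁c c hYc
    have hx₆ : Module.finrank ℂ (LinearMap.range (X₆.restrict (hcp X₆ hX₆c))) = 6 := by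
      rw [UnitaryLeviRank.finrank_range_restrict, hi6]
    have hx₁ : Module.finrank ℂ (LinearMap.range (X₁.restrict (hcm X₁ hX₁c))) = 5 := by
      rw [UnitaryLeviRank.finrank_range_restrict, hj5]
    have hsumY := hsum (X₆ + c • X₁) hY hΘY hYΘ hYc
    rw [hiY, hjY] at hsumY
    omega
  -- kills in `L⁺` (type `(9 | 6)`): `i ∉ {1, 2, 4, 5}`
  have hkillp : ∀ X ∈ 𝔊, Θ * X = X → X * Θ = -X → X * ι = ι * X →
      Module.finrank ℂ (Up.map X) ≠ 1 ∧ Module.finrank ℂ (Up.map X) ≠ 2 ∧ Module.finrank ℂ (Up.map X) ≠ 4 ∧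
        Module.finrank ℂ (Up.map X) ≠ 5 := by
    intro X hX hΘX hXΘ hXc
    obtain ⟨hymem, hιpy, hyιp, hyrk⟩ := UnitaryLeviSetup.restrict_mem hcp hLp hιpapply X hX hΘX hXΘ hXc
    have hk1 : Module.finrank ℂ (Up.map X) = 1 → False := fun hi => by
      rw [hi] at hyrk
      exact hfullp_of (UnitaryRankOneRaise.eq_top_of_rankOne_raise hbrLp hirrLp hιpmem hιpιp hPp hQp
        (s := fun v w : Up => s (v : W) w) (hsU Up) (fun v w => hsymm v w) hPpQp hdefPp hdefQp hadjLp hymem hιpy hyιp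
        hyrk (by omega) (by omega) (by omega))
    have hk : ∀ i, Module.finrank ℂ (Up.map X) = i → (i = 2 ∨ i = 4 ∨ i = 5) → False := by
      intro i hi his
      rw [hi] at hyrk
      refine hfullp_of (UnitaryDoubleLevi.eq_top_of_raise_of_core' hbrLp hirrLp hιpmem hιpιp hPp hQp
        (s := fun v w : Up => s (v : W) w) (hsU Up) (fun v w => hsymm v w) hPpQp hdefPp hdefQp hadjLp hymem hιpy hyιp
        (by rw [hyrk]; omega) (by omega) (by omega)
        fun U' 𝔩' ι' P' Q' hbr𝔩' hirr𝔩' hι' hι'ι' hP' hQ' hfinP' hfinQ' hP'Q' hdefP' hdefQ' hadj𝔩' => ?_)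
      rw [hyrk] at hfinP' hfinQ'
      rcases his with rfl | rfl | rfl
      · exact UnitaryTwoOdd.eq_top hbr𝔩' hirr𝔩' hι' hι'ι' hP' hQ' hfinP' ⟨3, by omega⟩
          (s := fun v w : U' => s ((v : Up) : W) w) (fun v w z => by simp only [Submodule.coe_add, hadd])
          (fun v w => hsymm _ _) hP'Q' hdefP' hdefQ' hadj𝔩'
      · exact UnitaryFourOdd.eq_top hbr𝔩' hirr𝔩' hι' hι'ι' hP' hQ' hfinP' ⟨2, by omega⟩
          (s := fun v w : U' => s ((v : Up) : W) w) (fun v w z => by simp only [Submodule.coe_add, hadd])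
          (fun v w => hsymm _ _) hP'Q' hdefP' hdefQ' hadj𝔩'
      · exact UnitaryFive.eq_top hbr𝔩' hirr𝔩' hι' hι'ι' hP' hQ' hfinP' (Or.inr (by omega))
          (s := fun v w : U' => s ((v : Up) : W) w) (fun v w z => by simp only [Submodule.coe_add, hadd])
          (fun v w => hsymm _ _) hP'Q' hdefP' hdefQ' hadj𝔩'
    exact ⟨hk1, fun h => hk 2 h (by omega), fun h => hk 4 h (by omega), fun h => hk 5 h (by omega)⟩
  -- kills in `L⁻` (type `(6 | 10)`): `j ∉ {1, 3}`
  have hkillm : ∀ X ∈ 𝔊, Θ * X = X → X * Θ = -X → X * ι = ι * X →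
      Module.finrank ℂ (Um.map X) ≠ 1 ∧ Module.finrank ℂ (Um.map X) ≠ 3 := by
    intro X hX hΘX hXΘ hXc
    obtain ⟨hxmem, hιmx, hxιm, hxrk⟩ := UnitaryLeviSetup.restrict_mem hcm hLm hιmapply X hX hΘX hXΘ hXc
    refine ⟨fun hj => ?_, fun hj => ?_⟩
    · rw [hj] at hxrk
      exact hfullm_of (UnitaryRankOneRaise.eq_top_of_rankOne_raise hbrLm hirrLm hιmmem hιmιm hPm hQm
        (s := fun v w : Um => s (v : W) w) (hsU Um) (fun v w => hsymm v w) hPmQm hdefPm hdefQm hadjLm hxmem hιmx hxιm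
        hxrk (by omega) (by omega) (by omega))
    · rw [hj] at hxrk
      refine hfullm_of (UnitaryDoubleLevi.eq_top_of_raise_of_core hbrLm hirrLm hιmmem hιmιm hPm hQm
        (s := fun v w : Um => s (v : W) w) (hsU Um) (fun v w => hsymm v w) hPmQm hdefPm hdefQm hadjLm hxmem hιmx hxιm
        (by rw [hxrk]; omega) (by omega) (by omega)
        fun U' 𝔩' ι' P' Q' hbr𝔩' hirr𝔩' hι' hι'ι' hP' hQ' hfinP' hfinQ' hP'Q' hdefP' hdefQ' hadj𝔩' => ?_)
      rw [hxrk] at hfinP' hfinQ'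
      exact UnitaryThreeCoprime.eq_top hbr𝔩' hirr𝔩' hι' hι'ι' hP' hQ' hfinP' (by omega)
        (s := fun v w : U' => s ((v : Um) : W) w) (fun v w z => by simp only [Submodule.coe_add, hadd])
        (fun v w => hsymm _ _) hP'Q' hdefP' hdefQ' hadj𝔩'
  -- the profiles are `(0, 0)`, `(0, 6)`, `(6, 0)`
  have hprof : ∀ X ∈ 𝔊, Θ * X = X → X * Θ = -X → X * ι = ι * X →
      (Module.finrank ℂ (Up.map X) = 0 ∧ Module.finrank ℂ (Um.map X) = 0) ∨
        (Module.finrank ℂ (Up.map X) = 0 ∧ Module.finrank ℂ (Um.map X) = 6) ∨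
        (Module.finrank ℂ (Up.map X) = 6 ∧ Module.finrank ℂ (Um.map X) = 0) := by
    intro X hX hΘX hXΘ hXc
    obtain ⟨hs, hi, hi', hj, hj'⟩ := hsplit X hΘX hXΘ hXc
    obtain ⟨hp1, hp2, hp4, hp5⟩ := hkillp X hX hΘX hXΘ hXc
    obtain ⟨hm1, hm3⟩ := hkillm X hX hΘX hXΘ hXc
    have hrk := hS X hX hΘX hXΘ
    have hle := hsum X hX hΘX hXΘ hXc
    rw [hs] at hrk
    omega
  -- `X₀` moves `U⁺`, `Y₀` moves `U⁻`; two pencils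
  obtain ⟨⟨p, hp⟩, hp0⟩ := Module.finrank_pos_iff_exists_ne_zero.1 (show 0 < Module.finrank ℂ PU by omega)
  obtain ⟨⟨q, hq⟩, hq0⟩ := Module.finrank_pos_iff_exists_ne_zero.1 (show 0 < Module.finrank ℂ QU by omega)
  obtain ⟨X₀, hX₀, hΘX₀, hX₀Θ, hX₀c, c₀, hιc₀, -, hX₀c0⟩ :=
    UnitaryLeviFull.exists_raise_commute_apply_ne_zero hbr hirr hΘ hΘΘ hQ hιmem hιι hιΘ hUm hUp
      ⟨p, fun h => hp0 (Subtype.ext h), ((hPU p).1 hp).1, ((hPU p).1 hp).2⟩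
      ⟨q, fun h => hq0 (Subtype.ext h), ((hQU q).1 hq).1, ((hQU q).1 hq).2⟩
  have hX₀i : Module.finrank ℂ (Up.map X₀) = 6 := by
    have hmem : X₀ c₀ ∈ Up.map X₀ := Submodule.mem_map_of_mem ((hUp c₀).2 hιc₀)
    rcases hprof X₀ hX₀ hΘX₀ hX₀Θ hX₀c with ⟨h0, -⟩ | ⟨h0, -⟩ | ⟨h6, -⟩
    · rw [Submodule.finrank_eq_zero.1 h0, Submodule.mem_bot] at hmem; exact absurd hmem hX₀c0
    · rw [Submodule.finrank_eq_zero.1 h0, Submodule.mem_bot] at hmem; exact absurd hmem hX₀c0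
    · exact h6
  have hnι : -ι ∈ 𝔊 := Submodule.neg_mem _ hιmem
  have hnιι : (-ι) * (-ι) = 1 := by rw [neg_mul_neg, hιι]
  have hnιΘ : (-ι) * Θ = Θ * (-ι) := by rw [neg_mul, mul_neg, hιΘ]
  have hUm' : ∀ x, x ∈ Um ↔ (-ι) x = x := fun x => by rw [hUm, LinearMap.neg_apply, neg_eq_iff_eq_neg]
  have hUp' : ∀ x, x ∈ Up ↔ (-ι) x = -x := fun x => by rw [hUp, LinearMap.neg_apply, neg_inj]
  obtain ⟨⟨u, hu⟩, hu0⟩ := Module.finrank_pos_iff_exists_ne_zero.1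
    (show 0 < Module.finrank ℂ (LinearMap.range B) by omega)
  obtain ⟨⟨d₀, hd₀⟩, hd₀0⟩ := Module.finrank_pos_iff_exists_ne_zero.1
    (show 0 < Module.finrank ℂ ↥(Q ⊓ LinearMap.ker B) by omega)
  obtain ⟨Y₀, hY₀, hΘY₀, hY₀Θ, hY₀c', d, hιd, -, hY₀d⟩ :=
    UnitaryLeviFull.exists_raise_commute_apply_ne_zero hbr hirr hΘ hΘΘ hQ hnι hnιι hnιΘ hUp' hUm'
      ⟨u, fun h => hu0 (Subtype.ext h), by rw [LinearMap.neg_apply, ((hPM u).1 hu).1, neg_neg], ((hPM u).1 hu).2⟩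
      ⟨d₀, fun h => hd₀0 (Subtype.ext h), by rw [LinearMap.neg_apply, ((hQM d₀).1 hd₀).1, neg_neg], ((hQM d₀).1 hd₀).2⟩
  have hY₀c : Y₀ * ι = ι * Y₀ := by rw [mul_neg, neg_mul, neg_inj] at hY₀c'; exact hY₀c'
  have hY₀j : Module.finrank ℂ (Um.map Y₀) = 6 := by
    have hmem : Y₀ d ∈ Um.map Y₀ := Submodule.mem_map_of_mem ((hUm' d).2 hιd)
    rcases hprof Y₀ hY₀ hΘY₀ hY₀Θ hY₀c with ⟨-, h0⟩ | ⟨-, h6⟩ | ⟨-, h0⟩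
    · rw [Submodule.finrank_eq_zero.1 h0, Submodule.mem_bot] at hmem; exact absurd hmem hY₀d
    · exact h6
    · rw [Submodule.finrank_eq_zero.1 h0, Submodule.mem_bot] at hmem; exact absurd hmem hY₀d
  obtain ⟨c, hc1, hc2⟩ := UnitaryGenericRank.exists_finrank_le_and_finrank_le (Y₀.restrict (hcm Y₀ hY₀c))
    (X₀.restrict (hcm X₀ hX₀c)) (X₀.restrict (hcp X₀ hX₀c)) (Y₀.restrict (hcp Y₀ hY₀c))
  obtain ⟨hZ, hΘZ, hZΘ, hZc⟩ := UnitaryLeviSetup.add_smul_raise X₀ hX₀ hΘX₀ hX₀Θ hX₀c Y₀ hY₀ hΘY₀ hY₀Θ hY₀c c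
  have hiZ := UnitaryLeviSetup.finrank_map_add_smul hcp X₀ Y₀ hX₀c hY₀c c hZc
  have hjZ := UnitaryLeviSetup.finrank_map_add_smul hcm X₀ Y₀ hX₀c hY₀c c hZc
  have hx₀ : Module.finrank ℂ (LinearMap.range (X₀.restrict (hcp X₀ hX₀c))) = 6 := by
    rw [UnitaryLeviRank.finrank_range_restrict, hX₀i]
  have hy₀ : Module.finrank ℂ (LinearMap.range (Y₀.restrict (hcm Y₀ hY₀c))) = 6 := by
    rw [UnitaryLeviRank.finrank_range_restrict, hY₀j]
  have hsumZ := hsum (X₀ + c • Y₀) hZ hΘZ hZΘ hZc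
  rw [hiZ, hjZ] at hsumZ
  omega

/-- (G10) At `(15, 16)` with ranks in `{0, 8, 10}`, no raising operator has rank `8`: at such a `B` (Levi types
`(7 | 8)` / `(8 | 8)`) `XCX = 0` gives `i + j ∈ {0, 8}`; `L⁺` is full (`UnitarySeven.eq_top_of_smul`, `7 ∤ 8`), and
lifts of profiles `(7, 1)` and `(1, 7)` with two pencils give rank `14`. [cite: Ribet1983, Thm. 3]
[cite: Gordon1997, Thm. 6.3 (3)] [cite: Deligne1982HodgeCycles, I §3 Prop. 3.4, 3.6] [cite: GoodmanWallachGTM255, §4.1.1]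
[cite: HoffmanKunze1971LinearAlgebra, §3.1 Thm. 2] -/
theorem UnitaryFifteenSixteen.no_rank_eight [FiniteDimensional ℂ W] {𝔊 : Submodule ℂ (Module.End ℂ W)}
    (hbr : ∀ Y ∈ 𝔊, ∀ Z ∈ 𝔊, Y * Z - Z * Y ∈ 𝔊)
    (hirr : ∀ U : Submodule ℂ W, (∀ A ∈ 𝔊, ∀ u ∈ U, A u ∈ U) → U = ⊥ ∨ U = ⊤)
    {Θ : Module.End ℂ W} (hΘ : Θ ∈ 𝔊) (hΘΘ : Θ * Θ = 1)
    {P Q : Submodule ℂ W} (hP : ∀ x, x ∈ P ↔ Θ x = x) (hQ : ∀ x, x ∈ Q ↔ Θ x = -x)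
    (hP15 : Module.finrank ℂ P = 15)
    {s : W → W → ℂ} (hadd : ∀ x y z, s (x + y) z = s x z + s y z)
    (hsmul : ∀ (c : ℂ) (x y : W), s (c • x) y = c * s x y) (hsymm : ∀ x y, s y x = starRingEnd ℂ (s x y))
    (hPQ : ∀ p ∈ P, ∀ q ∈ Q, s p q = 0) (hdefP : ∀ p ∈ P, s p p = 0 → p = 0) (hdefQ : ∀ q ∈ Q, s q q = 0 → q = 0)
    (hadj : ∀ X ∈ 𝔊, ∃ Y ∈ 𝔊, ∀ x y, s (X x) y = s x (Y y))
    (hS : ∀ B' ∈ 𝔊, Θ * B' = B' → B' * Θ = -B' →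
      Module.finrank ℂ (LinearMap.range B') = 0 ∨ Module.finrank ℂ (LinearMap.range B') = 8 ∨ Module.finrank ℂ (LinearMap.range B') = 10)
    {B : Module.End ℂ W} (hB : B ∈ 𝔊) (hΘB : Θ * B = B) (hBΘ : B * Θ = -B)
    (hr : Module.finrank ℂ (LinearMap.range B) = 8) : False := by
  classical
  have hsU : ∀ U : Submodule ℂ W, ∀ x y z : U, s ((x + y : U) : W) z = s (x : W) z + s (y : W) z :=
    fun U x y z => by simp only [Submodule.coe_add, hadd]
  have hno1 : ∀ B' ∈ 𝔊, Θ * B' = B' → B' * Θ = -B' → Module.finrank ℂ (LinearMap.range B') ≠ 1 := by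
    intro B' hB' hΘB' hB'Θ h1
    rcases hS B' hB' hΘB' hB'Θ with h | h | h <;> omega
  obtain ⟨ι, Um, Up, PU, QU, Lm, ιm, Pm, Qm, Lp, ιp, Pp, Qp, hιmem, hιι, hιΘ, hιs, hUm, hUp, hfinUm, hfinUp,
    hPM, hQM, hPU, hQU, hrangeP, hPUP, hQUQ, hfinQM, hfinPU, hfinQU, hLm, hLp,
    hιmapply, hPmmem, hQmmem, hbrLm, hirrLm, hιmmem, hιmιm, hPm, hQm, hfinPm, hfinQm, hPmQm, hdefPm, hdefQm, hadjLm,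
    hιpapply, hPpmem, hQpmem, hbrLp, hirrLp, hιpmem, hιpιp, hPp, hQp, hfinPp, hfinQp, hPpQp, hdefPp, hdefQp, hadjLp,
    hsplit⟩ :=
    UnitaryLeviSetup.exists_levi_pair hbr hirr hΘ hΘΘ hP hQ hadd hsymm hPQ hdefP hdefQ hadj hB hΘB hBΘ
  have hfinQU' := hfinQU
  rw [hr] at hfinQM hfinPU hfinQU' hfinPm hfinQm hfinPp hfinQp hsplit
  rw [hP15] at hfinPU hfinPp hfinUp
  have hcm : ∀ Z : Module.End ℂ W, Z * ι = ι * Z → ∀ x ∈ Um, Z x ∈ Um := fun Z hZ x hx =>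
    (hUm _).2 (by rw [← Module.End.mul_apply, ← hZ, Module.End.mul_apply, (hUm x).1 hx, map_neg])
  have hcp : ∀ Z : Module.End ℂ W, Z * ι = ι * Z → ∀ x ∈ Up, Z x ∈ Up := fun Z hZ x hx =>
    (hUp _).2 (by rw [← Module.End.mul_apply, ← hZ, Module.End.mul_apply, (hUp x).1 hx])
  -- the adjoint `C` of `B` and the `XCX` identity
  obtain ⟨C, hC, hBC⟩ := hadj B hB
  obtain ⟨hCPU, hCim, hCinj, hCQ⟩ := UnitaryLeviSetup.adj_compat hΘΘ hP hQ hadd hsymm hPQ hdefP hdefQ hΘB hBΘ hBC hrangeP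
    hιι hιΘ hιs hPM hQM
  have hXCX : ∀ X ∈ 𝔊, Θ * X = X → X * Θ = -X → X * ι = ι * X →
      X * C * X ∈ 𝔊 ∧ Θ * (X * C * X) = X * C * X ∧ X * C * X * Θ = -(X * C * X) ∧
        Module.finrank ℂ (LinearMap.range (X * C * X)) ≤ Module.finrank ℂ (Up.map X) ∧
        Module.finrank ℂ (LinearMap.range (X * C * X)) ≤ Module.finrank ℂ (Um.map X) := by
    intro X hX hΘX hXΘ hXc
    have hT2 := UnitaryRaisingSpace.bracket_bracket_mem hbr hX hC hX hΘX hXΘ hΘX hXΘ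
    have hTmem : X * C * X ∈ 𝔊 := by
      have h := Submodule.smul_mem 𝔊 ((2 : ℂ)⁻¹) hT2
      rwa [← two_smul ℂ, smul_smul, inv_mul_cancel₀ (two_ne_zero (α := ℂ)), one_smul] at h
    obtain ⟨hle1, hle2⟩ := UnitaryLeviSetup.finrank_range_mul_adj_mul_le hιι hUm hUp hPM hCPU hCim hΘX hXc
    exact ⟨hTmem, by rw [← mul_assoc, ← mul_assoc, hΘX], by rw [mul_assoc, hXΘ, mul_neg], hle1, hle2⟩
  have hsmU : ∀ U : Submodule ℂ W, ∀ (c : ℂ) (x y : U), s ((c • x : U) : W) y = c * s (x : W) y :=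
    fun U c x y => by simp only [Submodule.coe_smul, hsmul]
  -- `XCX = 0` for every raising `X` commuting with `ι`: `i + j ≤ 8`
  have hsum : ∀ X ∈ 𝔊, Θ * X = X → X * Θ = -X → X * ι = ι * X →
      Module.finrank ℂ (Up.map X) + Module.finrank ℂ (Um.map X) ≤ 8 := by
    intro X hX hΘX hXΘ hXc
    obtain ⟨hs, hi, hi', hj, hj'⟩ := hsplit X hΘX hXΘ hXc
    have hrk := hS X hX hΘX hXΘ
    rw [hs] at hrk
    obtain ⟨hTmem, hΘT, hTΘ, hle1, hle2⟩ := hXCX X hX hΘX hXΘ hXc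
    have hT0 : X * C * X = 0 := by
      have h := hS _ hTmem hΘT hTΘ
      have h0 : Module.finrank ℂ (LinearMap.range (X * C * X)) = 0 := by omega
      exact LinearMap.range_eq_bot.1 (Submodule.finrank_eq_zero.1 h0)
    have h := UnitaryLeviSetup.finrank_add_finrank_le hΘΘ hιι hιΘ hUm hUp hPM hQU hfinQU hCim hCinj hCQ hΘX hXΘ hXc hT0
    rw [hr] at h
    exact h
  -- `L⁺` (type `(7 | 8)`) is full; lifts of profiles `(7, 1)` and `(1, 7)`
  have hLptop : Lp = ⊤ :=
    UnitarySeven.eq_top_of_smul hbrLp hirrLp hιpmem hιpιp hPp hQp (by omega) (by omega)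
      (s := fun v w : Up => s (v : W) w) (hsU Up) (hsmU Up) (fun v w => hsymm v w) hPpQp hdefPp hdefQp hadjLp
  have hfullp : ∀ T : Module.End ℂ Up, ∃ Z ∈ 𝔊, Z * ι = ι * Z ∧ ∀ v : Up, ((T v : Up) : W) = Z v := fun T =>
    (hLp T).1 (by rw [hLptop]; exact Submodule.mem_top)
  obtain ⟨X₇, hX₇, hΘX₇, hX₇Θ, hX₇c, h7le⟩ := UnitaryLeviSetup.exists_lift_le_finrank hbr hΘ hΘΘ hcp hιΘ hLp hιpapply
    hιpιp hPp hQp hLptop (k := 7) (by omega) (by omega)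
  obtain ⟨X₁, hX₁, hΘX₁, hX₁Θ, hX₁c, hi1⟩ := UnitaryLeviSetup.exists_lift_rankOne hbr hΘ hΘΘ hιΘ hUp hPU hQU (by omega)
    (by omega) hfullp
  obtain ⟨hs₇, hi₇, -, -, -⟩ := hsplit X₇ hΘX₇ hX₇Θ hX₇c
  obtain ⟨hs₁, -, -, -, -⟩ := hsplit X₁ hΘX₁ hX₁Θ hX₁c
  have hsum₇ := hsum X₇ hX₇ hΘX₇ hX₇Θ hX₇c
  have hsum₁ := hsum X₁ hX₁ hΘX₁ hX₁Θ hX₁c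
  have hrk₁ := hS X₁ hX₁ hΘX₁ hX₁Θ
  rw [hs₁, hi1] at hrk₁
  have hj7 : Module.finrank ℂ (Um.map X₁) = 7 := by omega
  have hi7 : Module.finrank ℂ (Up.map X₇) = 7 := by omega
  obtain ⟨c, hc1, hc2⟩ := UnitaryGenericRank.exists_finrank_le_and_finrank_le (X₁.restrict (hcm X₁ hX₁c))
    (X₇.restrict (hcm X₇ hX₇c)) (X₇.restrict (hcp X₇ hX₇c)) (X₁.restrict (hcp X₁ hX₁c))
  obtain ⟨hY, hΘY, hYΘ, hYc⟩ := UnitaryLeviSetup.add_smul_raise X₇ hX₇ hΘX₇ hX₇Θ hX₇c X₁ hX₁ hΘX₁ hX₁Θ hX₁c c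
  have hiY := UnitaryLeviSetup.finrank_map_add_smul hcp X₇ X₁ hX₇c hX₁c c hYc
  have hjY := UnitaryLeviSetup.finrank_map_add_smul hcm X₇ X₁ hX₇c hX₁c c hYc
  have hx₇ : Module.finrank ℂ (LinearMap.range (X₇.restrict (hcp X₇ hX₇c))) = 7 := by
    rw [UnitaryLeviRank.finrank_range_restrict, hi7]
  have hx₁ : Module.finrank ℂ (LinearMap.range (X₁.restrict (hcm X₁ hX₁c))) = 7 := by
    rw [UnitaryLeviRank.finrank_range_restrict, hj7]
  have hsumY := hsum (X₇ + c • X₁) hY hΘY hYΘ hYc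
  rw [hiY, hjY] at hsumY
  omega

/-! ### §3 The `(15 | 16)` core and its mirror -/

/-- **THE `Θ`-SUBALGEBRA THEOREM FOR UNITARY MULTIPLICITIES `(15, 16)` — complex Hermitian core, classification-free.**
`𝔊 ⊆ End(W)` bracket-closed and irreducible, `Θ ∈ 𝔊` an involution with `dim P = 15`, `dim Q = 16`, Hermitian data
(`s` additive and `ℂ`-homogeneous in the first slot, Hermitian-symmetric, `P ⊥ Q`, definite on `P` and on `Q`), `𝔊`
adjoint-closed ⟹ `𝔊 = End(W)`. A proper `𝔊` would have maximal raising rank `10` and ranks in `{0, 4, 6, 8, 10}`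
(`UnitaryFifteenSixteen.exists_maxRank_ten_of_ne_top`); §2 removes `4`, `6`, `8` in turn, and the constant rank `10`
is excluded by `UnitaryFifteenSixteen.no_constRank_ten`. [cite: Ribet1983, Thm. 3] [cite: Gordon1997, Thm. 6.3 (3)]
[cite: Deligne1982HodgeCycles, I §3 Prop. 3.4, 3.6] [cite: GoodmanWallachGTM255, §4.1.1] -/
theorem UnitaryFifteenSixteen.eq_top_of_smul [FiniteDimensional ℂ W] {𝔊 : Submodule ℂ (Module.End ℂ W)}
    (hbr : ∀ Y ∈ 𝔊, ∀ Z ∈ 𝔊, Y * Z - Z * Y ∈ 𝔊)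
    (hirr : ∀ U : Submodule ℂ W, (∀ A ∈ 𝔊, ∀ u ∈ U, A u ∈ U) → U = ⊥ ∨ U = ⊤)
    {Θ : Module.End ℂ W} (hΘ : Θ ∈ 𝔊) (hΘΘ : Θ * Θ = 1)
    {P Q : Submodule ℂ W} (hP : ∀ x, x ∈ P ↔ Θ x = x) (hQ : ∀ x, x ∈ Q ↔ Θ x = -x)
    (hP15 : Module.finrank ℂ P = 15) (hQ16 : Module.finrank ℂ Q = 16)
    {s : W → W → ℂ} (hadd : ∀ x y z, s (x + y) z = s x z + s y z)
    (hsmul : ∀ (c : ℂ) (x y : W), s (c • x) y = c * s x y) (hsymm : ∀ x y, s y x = starRingEnd ℂ (s x y))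
    (hPQ : ∀ p ∈ P, ∀ q ∈ Q, s p q = 0) (hdefP : ∀ p ∈ P, s p p = 0 → p = 0) (hdefQ : ∀ q ∈ Q, s q q = 0 → q = 0)
    (hadj : ∀ X ∈ 𝔊, ∃ Y ∈ 𝔊, ∀ x y, s (X x) y = s x (Y y)) : 𝔊 = ⊤ := by
  by_contra hne
  obtain ⟨⟨B, hB, hΘB, hBΘ, -, h10⟩, hS₁⟩ := UnitaryFifteenSixteen.exists_maxRank_ten_of_ne_top hbr hirr hΘ hΘΘ hP hQ
    hP15 hQ16 hadd hsmul hsymm hPQ hdefP hdefQ hadj hne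
  have hno4 : ∀ B' ∈ 𝔊, Θ * B' = B' → B' * Θ = -B' → Module.finrank ℂ (LinearMap.range B') ≠ 4 :=
    fun B' hB' hΘB' hB'Θ h4 => UnitaryFifteenSixteen.no_rank_four hbr hirr hΘ hΘΘ hP hQ hP15 hQ16 hadd hsymm hPQ hdefP
      hdefQ hadj hS₁ hB' hΘB' hB'Θ h4
  have hS₂ : ∀ B' ∈ 𝔊, Θ * B' = B' → B' * Θ = -B' →
      Module.finrank ℂ (LinearMap.range B') = 0 ∨ Module.finrank ℂ (LinearMap.range B') = 6 ∨ Module.finrank ℂ (LinearMap.range B') = 8 ∨ Module.finrank ℂ (LinearMap.range B') = 10 := by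
    intro B' hB' hΘB' hB'Θ
    have h := hno4 B' hB' hΘB' hB'Θ
    rcases hS₁ B' hB' hΘB' hB'Θ with h' | h' | h' | h' | h' <;> omega
  have hno6 : ∀ B' ∈ 𝔊, Θ * B' = B' → B' * Θ = -B' → Module.finrank ℂ (LinearMap.range B') ≠ 6 :=
    fun B' hB' hΘB' hB'Θ h6 => UnitaryFifteenSixteen.no_rank_six hbr hirr hΘ hΘΘ hP hQ hP15 hQ16 hadd hsymm hPQ hdefP
      hdefQ hadj hS₂ hB' hΘB' hB'Θ h6
  have hS₃ : ∀ B' ∈ 𝔊, Θ * B' = B' → B' * Θ = -B' →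
      Module.finrank ℂ (LinearMap.range B') = 0 ∨ Module.finrank ℂ (LinearMap.range B') = 8 ∨ Module.finrank ℂ (LinearMap.range B') = 10 := by
    intro B' hB' hΘB' hB'Θ
    have h := hno6 B' hB' hΘB' hB'Θ
    rcases hS₂ B' hB' hΘB' hB'Θ with h' | h' | h' | h' <;> omega
  have hno8 : ∀ B' ∈ 𝔊, Θ * B' = B' → B' * Θ = -B' → Module.finrank ℂ (LinearMap.range B') ≠ 8 :=
    fun B' hB' hΘB' hB'Θ h8 => UnitaryFifteenSixteen.no_rank_eight hbr hirr hΘ hΘΘ hP hQ hP15 hadd hsmul hsymm hPQ hdefP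
      hdefQ hadj hS₃ hB' hΘB' hB'Θ h8
  have hS₄ : ∀ B' ∈ 𝔊, Θ * B' = B' → B' * Θ = -B' →
      Module.finrank ℂ (LinearMap.range B') = 0 ∨ Module.finrank ℂ (LinearMap.range B') = 10 := by
    intro B' hB' hΘB' hB'Θ
    have h := hno8 B' hB' hΘB' hB'Θ
    rcases hS₃ B' hB' hΘB' hB'Θ with h' | h' | h' <;> omega
  exact UnitaryFifteenSixteen.no_constRank_ten hbr hirr hΘ hΘΘ hP hQ hP15 hQ16 hadd hsymm hPQ hdefP hdefQ hadj hS₄ hB hΘB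
    hBΘ h10

/-- **The mirror core `(16, 15)`** (apply `eq_top_of_smul` to `−Θ`). [cite: Ribet1983, Thm. 3]
[cite: Gordon1997, Thm. 6.3 (3)] -/
theorem UnitaryFifteenSixteen.eq_top_of_smul' [FiniteDimensional ℂ W] {𝔊 : Submodule ℂ (Module.End ℂ W)}
    (hbr : ∀ Y ∈ 𝔊, ∀ Z ∈ 𝔊, Y * Z - Z * Y ∈ 𝔊)
    (hirr : ∀ U : Submodule ℂ W, (∀ A ∈ 𝔊, ∀ u ∈ U, A u ∈ U) → U = ⊥ ∨ U = ⊤)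
    {Θ : Module.End ℂ W} (hΘ : Θ ∈ 𝔊) (hΘΘ : Θ * Θ = 1)
    {P Q : Submodule ℂ W} (hP : ∀ x, x ∈ P ↔ Θ x = x) (hQ : ∀ x, x ∈ Q ↔ Θ x = -x)
    (hP16 : Module.finrank ℂ P = 16) (hQ15 : Module.finrank ℂ Q = 15)
    {s : W → W → ℂ} (hadd : ∀ x y z, s (x + y) z = s x z + s y z)
    (hsmul : ∀ (c : ℂ) (x y : W), s (c • x) y = c * s x y) (hsymm : ∀ x y, s y x = starRingEnd ℂ (s x y))
    (hPQ : ∀ p ∈ P, ∀ q ∈ Q, s p q = 0) (hdefP : ∀ p ∈ P, s p p = 0 → p = 0) (hdefQ : ∀ q ∈ Q, s q q = 0 → q = 0)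
    (hadj : ∀ X ∈ 𝔊, ∃ Y ∈ 𝔊, ∀ x y, s (X x) y = s x (Y y)) : 𝔊 = ⊤ := by
  have hnΘ : -Θ ∈ 𝔊 := Submodule.neg_mem _ hΘ
  have hnΘΘ : (-Θ) * (-Θ) = 1 := by rw [neg_mul_neg, hΘΘ]
  exact UnitaryFifteenSixteen.eq_top_of_smul hbr hirr hnΘ hnΘΘ (P := Q) (Q := P)
    (fun x => by rw [hQ, LinearMap.neg_apply, neg_eq_iff_eq_neg]) (fun x => by rw [hP, LinearMap.neg_apply, neg_inj])
    hQ15 hP16 hadd hsmul hsymm (fun p hp q hq => by rw [hsymm, hPQ q hq p hp, map_zero]) hdefQ hdefP hadj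

end HodgeStructure

end Literature.AlgebraicGeometry.Motives

end
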